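import Literature.Probability.LatticeModels.CollarLegModelStrandsConsistency

/-!
# The medial strand representation of the collar leg model, IV: cuts, strand ends and the
# RAINBOW event of a leg insertion

Fourth file of the strand representation of `Literature.Probability.LatticeModels.CollarLegModel`
[BaxterKellandWu1976, §3–§4] (after `CollarLegModelStrands`, `…Expansion`, `…Consistency`). It
names the combinatorial objects of the insertion dictionary
`‖Zins V ι‖ = #{ω ⊆ E : Rainbow ι V ω}` (module docstring of `CollarLegModel`, validation §):

* `CollarLegModel.IsCut M c` — the turn at the end of the corner `c` is a CUT of the model: its
  target edge is frozen and the turn is not a consistent tracked turn FOR THE PRESCRIBED DATA (read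
  with the zero height configuration and the completed configuration of `∅`; for the jump collar of
  an admissible datum neither the height configuration nor the live edges matter here — the cells a
  frozen tracked turn compares are prescribed). Cuts are the jump edges (rule (D1)), the far edges
  of the collar faces at junction ghosts, and the untracked outer turns of ghosts.
* `CollarLegModel.Joined M ω c c'` — following the turning rule of the completed configuration of
  `ω` from `c`, one reaches `c'` before any cut: `c` and `c'` lie on one STRAND, `c` upstream.
* `LegInsertionData.strandEnds ι V` — the strand ends created by the level changes of the collar
  walk, each tagged with the LOWER level `m` of the level pair `(m, m+1)` its level line separates:
  a jump by `2` at the dart `(v, k)` (levels `ℓ → ℓ'` across the exterior edge at `v`) creates the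
  two ends `(v, k+3)` (in the face before) and `(v, k)` (in the face after), tagged
  `min ℓ ((ℓ+ℓ')/2)` and `min ℓ' ((ℓ+ℓ')/2)`; a junction by `1` (wired/free switch) creates one end
  at the ghost `g = v + dir k` of the dart: `(g, k+1)` (in the face after) when the arc closes,
  `(g, k+2)` (in the face before) when it opens, tagged `min ℓ ℓ'`. (Formulas for a STRAIGHT
  boundary at the footprint — the flatness hypothesis of every statement using them.)
* `LegInsertionData.Rainbow ι V ω` — **the rainbow event**: every two distinct strand ends with
  the same tag are joined by a strand of the completed configuration of `ω` (in one of the two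
  directions). For the rainbow datum of a leg family the collar level rises by `L` over the sink's
  footprint and falls by `L_i` over the `i`-th source's, so each tag `-L ≤ m < 0` labels exactly two
  ends and the matching is nested: `(2;2) ↔ {x ↔ y}`, `(1,1;2) ↔ {y ↔ [a,b]}`, … (SPEC §D4).

Everything here is a DEFINITION (decidable where it matters); the theorems — level pairs are
constant along strands, valid nonzero-weight configurations exist iff `Rainbow`, phases — are the
Layer-3 files of crux `BoundaryDefectGaussianR` (stmt-CriticalPhenomena-14132).

## References

* R. J. Baxter, S. B. Kelland, F. Y. Wu, J. Phys. A 9 (1976) 397–406, §3–§4. [BaxterKellandWu1976]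
-/

namespace Literature.Probability.LatticeModels

namespace CollarLegModel

open Finset

variable (M : CollarLegModel)

/-- **Cut turns.** The turn at the end of the corner `c` is a cut of the model `M`: the target edge
of `c` is not live, and the turn is not a consistent tracked turn for the prescribed data (read in
the zero height configuration and the completed configuration of no live edge — by the frozen
consistency lemma the choice is immaterial for the jump collar of an admissible datum). [cite: BaxterKellandWu1976, §4] -/
def IsCut (c : Site 2 × Fin 4) : Prop :=
  ¬M.TargetsLive c ∧ ¬M.TurnConsistent (fun _ => 0) (M.cfgOf ∅) c

/-- **Strand connection.** From `c`, following the turning rule of the completed configuration of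
`ω`, the corner `c'` is reached after `n ≤ 4·#vertexCells` turns none of which (strictly before
`c'`) is a cut: `c` and `c'` lie on one strand, `c` upstream of `c'`. [cite: BaxterKellandWu1976, §3] -/
def Joined (ω : Finset ((ℤ × ℤ) × Bool)) (c c' : Site 2 × Fin 4) : Prop :=
  ∃ n ≤ 4 * M.vertexCells.card, (nextCorner (M.cfgOf ω))^[n] c = c' ∧
    ∀ m < n, ¬M.IsCut ((nextCorner (M.cfgOf ω))^[m] c)

end CollarLegModel

namespace CollarLegModel.LegInsertionData

open Finset CollarLegModel

variable (ι : LegInsertionData) (V : Finset (ℤ × ℤ))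

/-- The strand ends created at one entry `(d, s, s')` of the collar walk (dart, state before, state
after): none if the level does not change; two at the vertex of the dart for a jump by `2`; one at
the ghost of the dart for a junction by `1` (face after when the arc closes, face before when it
opens). Each end is tagged with the lower level of its level pair. [cite: BaxterKellandWu1976, §4] -/
def endsAt (t : Dart × WalkState × WalkState) : List ((Site 2 × Fin 4) × ℤ) :=
  let v := t.1.1
  let k := t.1.2
  let ℓ := t.2.1.level
  let ℓ' := t.2.2.level
  if ℓ' = ℓ then []
  else if ℓ' = ℓ + 2 ∨ ℓ = ℓ' + 2 then
    [((toSite v, k + 3), min ℓ ((ℓ + ℓ') / 2)), ((toSite v, k), min ℓ' ((ℓ + ℓ') / 2))]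
  else if t.2.1.wired then [((toSite (dartTip t.1), k + 1), min ℓ ℓ')]
  else [((toSite (dartTip t.1), k + 2), min ℓ ℓ')]

/-- **The strand ends of the jump collar of `ι` on `V`**, with their tags (lower level of the level
pair): the ends created along the counter-clockwise collar walk from the sink. [cite: BaxterKellandWu1976, §4] -/
def strandEnds : Finset ((Site 2 × Fin 4) × ℤ) :=
  ((ι.walk V).flatMap (endsAt)).toFinset

/-- **The rainbow event** of the leg insertion `ι` on `V` for the set `ω` of open live edges: every
two distinct strand ends with the same tag are joined by a strand of the completed configuration of
`ω`. [cite: BaxterKellandWu1976, §3–§4] -/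
def Rainbow (ω : Finset ((ℤ × ℤ) × Bool)) : Prop :=
  ∀ e ∈ ι.strandEnds V, ∀ e' ∈ ι.strandEnds V, e.2 = e'.2 → e.1 ≠ e'.1 →
    (ι.model V).Joined ω e.1 e'.1 ∨ (ι.model V).Joined ω e'.1 e.1

end CollarLegModel.LegInsertionData

end Literature.Probability.LatticeModels
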